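import Summits.QuantumFields.BalabanUV.Beta.FP.PeriodisedBorderWardContactInstance

/-!
# `BalabanUV.Beta.FP.PeriodisedBorderIndexWard` — road «FP» for binder row D1, ROUTE T, (T-β-1) AT ORDER 1 FOR THE AVERAGING BLOCK:
# **THE PERIODISED ROOTED BORDER TABLE INSERTED ALONG A TORUS PURE-GAUGE DIRECTION IS THE COMMUTATOR OF THE AVERAGING ROWS WITH THE DIAGONAL GAUGE
# GENERATORS** — at the torus call's types, for every torus gauge parameter `s` (every column of `tgrad (fine Lc M′)`):
# `Σ_b tgrad F (b.1, inl b.2) s • Q₁₁^{b} = c • (R_s * Q₁₀ − Q₁₀ * E_s)`, `c = (Lc^{d+1}·stepScale d Lc j)⁻¹`, `E_s = diagonal (tdelta F b.1 s)` (a field leg rotates at the BASE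
# of its bond), `R_s = diagonal (tdelta F (Lc•p̄ + ρ) s)` (a multiplier rotates at the ROOT of its block); and along any torus gauge function `λ`:
# `Q₁^{(Dλ)} = c·(R_λ·Q₁₀ − Q₁₀·E_λ)` — an1's INDEX-slot Ward law of the one-slot table, periodised

HONEST DEPENDENCY (page 1, mandatory): continuum YM on T⁴ ⇐ BetaPertH ∧ nine spine estimates (0/9 proved); BetaPertH ⇐ (D1) ∧ (D4) ∧ CAP+tail;
G-an2-4 gates asym, D1 and NE2/3/4.  HONEST FRAMING (cell contract, verbatim): «discharging `BetaPertH` makes Bałaban's UV stability UNCONDITIONAL —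
a real constructive-QFT result; it is NOT the continuum limit and NOT the Clay problem.»  ABSOLUTE RULE (cell charter, verbatim): «No internally-minted
statement may enter as a cited fact. Every hypothesis is either kernel-proved in this package or a verbatim quotation of a PUBLISHED theorem with page
reference. The manuscript(s) under audit are NOT citable for their own disputed steps — they are the thing under adjudication; programme-internal
(2001/route/tribunal) claims are never citable.»  THIS MODULE is [folklore] re-indexing of FINITE sums over OUR typed objects, fed BY NAME by an1's index-slot
law `AveragingWardRootedStencils.divV_vhSAt_inr_inl` (its four-line proof replayed on the unfolded sum), gan24-leaf-02's summation-by-parts tools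
`GAN24.BorderGaugeLegContact.tsum_sum_dz_mul_eq` ∕ `tsum_mul_ite_sub_ite_mul`, g16∕g17's periodisation words (`PeriodisedBorderTables.dper_apply_of_blockCov`,
`PeriodisedBorderWardContact.tsum_linSymAt_translate_eq`, the support lemmas), gan24-leaf-05's `tgrad`∕`tdelta`; no `def`, no `def … : Prop`, nothing cited, 0 sorry;
0 estimates; 0∕4 row-D1 binders; NOT (T-β) complete (the Hessian block `K₁` and order 2 are the dictionary's ∕ on request; WHICH transports the OWNER's T-β assembly
`SliceTransportConjugationEnd.secondVar_kkt_conj_transport` takes is the OWNER's), NOT SDF, NOT D1, NOT BetaPertH, NOT continuum, NOT Clay.  «not in print; our bookkeeping».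

WHY (OWNER d1-p3 g17, N2B-DESIGN §23 (23b) «(T-β-1) COVARIANCE of the one-step literal to second order: the fine jets along `Π_big e_b` are the CONJUGATED jets of the
fine jets along `Π_small e_b`: `Q^{big}_n = (ĀQ^{small}A)_n` … these ARE the Ward rows of an1's tables, order by order»).  At order 1 with `A₀ = Ā₀ = 1` the word is
`Q₁^{big} = Q₁^{small} + Ā₁·Q₀ + Q₀·A₁`; the two insertion directions differ by a PURE GAUGE `Dψ` (`ψ` = difference of the two tree-gauge functions) and the insertion
table is LINEAR in the direction, so (T-β-1) at order 1 IS the statement that the table inserted along `Dψ` is the commutator `Ā₁·Q₀ + Q₀·A₁` with `Ā₁ = c·R_ψ`,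
`A₁ = −c·E_ψ` DIAGONAL — this file, for the rooted table of record.  Diagonal transports are jet-unimodular ((T-β-2) for the averaging block costs nothing).

CONTENT (generic `d`; box `M = L·M′`, in-block root `toSite r`, `r ∈ box`; every `j`).
* §1 [folklore] generic: a block-covariant family `V κ u` with finite supports (`hS` fluctuation slot, `hT` family index) and an INDEX-slot contact law
  `Σ_κ (V κ (w − e_κ) − V κ w) x z a b = ([p₁ x = w] − [z = w])·q x z a b` (`hlaw`): `translate_injective`, **`tsum_sum_dz_mul_family_of_indexLaw`** (by parts in the family
  index: `Σ'_u Σ_κ (ψ(u+e_κ) − ψ u)·V κ u x z a b = (ψ (p₁ x) − ψ z)·q x z a b`), **`sum_tgrad_mul_dper_of_indexLaw`** (family index on the box, copies summed by `dper`, the torus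
  gauge parameter `s`: `= (tdelta M (p₁ x) s − tdelta M z s)·q x z a b`), **`sum_tgrad_mul_perZ_dper_of_indexLaw`** (+ periodised in the fluctuation slot: `… · perZ M q x z a b`).
* §2 the rooted table: `sum_vhSAt_sub_inr_inl` (an1's law, `Σ`-form), **`sum_tgrad_mul_perZ_dper_vhSAt`** (`p₁ x = x + ρ`, `q = linSymAt ρ L`), `perZ_linSymAt_eq`
  (`perZ M (linSymAt ρ L) = c · perZ M (bhKStepAt d ρ L j)` on `(inr, inl)`), **`sum_tgrad_mul_perZ_dper_vhSAt_bhKStepAt`** (in the torus call's letters).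
* §3 matrix forms: **`torus_pureGauge_of_presentation`** ∕ **`torus_pureGauge_fun_of_presentation`** (ANY box `M = L·M″`, ANY multiplier presentation `(pμ, inr mμ)`,
  one gauge parameter `s` ∕ any gauge function `λ` — e.g. the Delta's coarse-coarse rows one level up); at the torus call's types (`hQ₁₀` VERBATIM from p313662 ∕ the Delta, multipliers at `coarsePt`, `Q₁₁^{b}` as in p314580):
  **`torus_Q11_pureGauge`** (one gauge parameter `s`) and **`torus_Q11_pureGauge_fun`** (any torus gauge function `λ`; `E_λ = diagonal (λ b.1)`,
  `R_λ = diagonal (Σ_s tdelta F (Lc•p̄ + ρ) s · λ s)`).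
* §4 **`torus_conj_first_averaging_word`** — IN THE OWNER's WORD SHAPE (`SliceTransportConjugationEnd.secondVar_kkt_conj_transport`, p317781): with `A₀ = Ā₀ = 1`,
  `A₁ := −c • E_λ`, `Ā₁ := c • R_λ`, for ANY direction `h`: `Ā₁ * Q₁₀ * A₀ + Ā₀ * Q₁^{(h)} * A₀ + Ā₀ * Q₁₀ * A₁ = Q₁^{(h + Dλ)}` — the conjugated first-order averaging
  word IS the insertion table along the gauge-shifted direction.
NOT HERE: the Hessian block's index-slot law (`K₁` of (T-β-1)); order 2 (`vh2Tab_siteWard₁∕₂` of `BorderWardSiteLaw` are the index-slot prototypes); the (0.4)-sym table; the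
identification of `ψ` with the difference of leaf-06's tree-gauge functions (the OWNER's T-β assembly).
Provenance: D1 formalisation swarm LEAF PROVER 02, unit b2b-balaban-beta-d1-formalise-leaf-02 gen 18, 2026-08-22.  No existing file touched.
-/

noncomputable section

open scoped BigOperators

namespace Summit.QuantumFields.BalabanUV.Beta.FP.PeriodisedBorderIndexWard

open Finset Matrix
open Literature.Probability.LatticeModels (Torus.proj)
open Literature.MathematicalPhysics.QuantumFieldTheory.Balaban1983to89
open Literature.MathematicalPhysics.QuantumFieldTheory.Balaban1983to89.Beta
open B4TorusKernel.MultiPeriod (translate translate_apply)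
open B5Prop11Plancherel (fine)
open B6Lemma24Torus (pbox mem_pbox)
open ExpKernelCalculus (MKer shiftK)
open AffineAveraging (Site box toSite unitVec dz)
open AveragingContours (blk)
open AveragingHessianKernelsRooted (vhSAt vhSAt_translate)
open KernelWard (divV)
open OneStepResolventKernel (Fib)
open Summit.QuantumFields.BalabanUV.Beta.BorderedHessian (bhKStepAt stepScale)
open Summit.QuantumFields.BalabanUV.Beta.AveragingWardRootedStencils (linSymAt divV_vhSAt_inr_inl)
open Summit.QuantumFields.BalabanUV.Beta.GAN24.BorderGaugeLegContact (tsum_mul_ite_sub_ite_mul tsum_sum_dz_mul_eq vhSAt_inr_inl_eq_zero_of_not_mem)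
open Summit.QuantumFields.BalabanUV.Beta.FP.KernelPeriodisationFib (Idx perF perF_apply perZ perZ_apply)
open Summit.QuantumFields.BalabanUV.Beta.FP.KernelPeriodisationFibLoc (dper)
open Summit.QuantumFields.BalabanUV.Beta.FP.KernelPeriodisationFibTrace (tsum_sites_eq_sum_tsum)
open Summit.QuantumFields.BalabanUV.Beta.FP.PeriodisedBorderTables (dper_apply_of_blockCov)
open Summit.QuantumFields.BalabanUV.Beta.FP.TorusGaugeCovariance (tdelta tdelta_translate tgrad tgrad_inl nearBox)
open Summit.QuantumFields.BalabanUV.Beta.FP.TorusGaugeCovarianceCoarse (coarsePt coarsePt_coe)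
open Summit.QuantumFields.BalabanUV.Beta.FP.TorusGaugeCovariancePairing (sum_tdelta_mul wrapPt_of_mem)
open Summit.QuantumFields.BalabanUV.Beta.FP.PeriodisedBorderWardContact (vhSAt_inr_inl_eq_zero_of_not_mem_family
  linSymAt_inr_inl_eq_zero_of_not_mem_family tsum_linSymAt_translate_eq)

variable {d : ℕ}

/-! ## §1 A block-covariant, finitely supported table family with an INDEX-slot (insertion-slot) contact law, inserted along a torus pure gauge -/

section Generic

variable {M M' : Fin (d + 1) → ℕ} [∀ μ, NeZero (M μ)] {N : ℕ}
  (V : Fin (d + 1) → Site (d + 1) → MKer (d + 1) (Fib d)) (q : MKer (d + 1) (Fib d)) (p₁ : Site (d + 1) → Site (d + 1))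
  (S T : Site (d + 1) → Finset (Site (d + 1))) (a b : Fib d)

/-- [folklore] translation in the family index is injective. -/
theorem translate_injective (u : Site (d + 1)) : Function.Injective fun m : Site (d + 1) => translate M u m := by
  intro m m' h
  funext i
  have hi := congrFun h i
  simp only [B4TorusKernel.MultiPeriod.translate_apply] at hi
  have hMi : (M i : ℤ) ≠ 0 := by exact_mod_cast NeZero.ne (M i)
  exact mul_left_cancel₀ hMi (by linarith)

/-- [folklore] **THE LATTICE INSERTION OF A PURE GAUGE, BY PARTS IN THE FAMILY INDEX**: with finite family support (`hT`) and the index-slot law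
`Σ_κ (V κ (w − e_κ) − V κ w) x z a b = ([p₁ x = w] − [z = w]) · q x z a b` (`hlaw`, an1's `divV` shape), for every potential `ψ`:
`Σ'_u Σ_κ (ψ (u + e_κ) − ψ u) · V κ u x z a b = (ψ (p₁ x) − ψ z) · q x z a b`. -/
theorem tsum_sum_dz_mul_family_of_indexLaw
    (hT : ∀ (κ : Fin (d + 1)) (x z : Site (d + 1)), ∀ u ∉ T x, V κ u x z a b = 0)
    (hlaw : ∀ (w x z : Site (d + 1)), ∑ κ, (V κ (w - unitVec κ) x z a b - V κ w x z a b)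
      = ((if p₁ x = w then (1 : ℝ) else 0) - (if z = w then 1 else 0)) * q x z a b)
    (ψ : Site (d + 1) → ℝ) (x z : Site (d + 1)) :
    ∑' u, ∑ κ, dz ψ κ u * V κ u x z a b = (ψ (p₁ x) - ψ z) * q x z a b := by
  rw [tsum_sum_dz_mul_eq (fun κ u => V κ u x z a b)
    (fun κ g => summable_of_ne_finset_zero (s := T x) fun u hu => by rw [hT κ x z u hu, mul_zero]) ψ]
  simp only [hlaw]
  exact tsum_mul_ite_sub_ite_mul ψ (p₁ x) z (q x z a b)

/-- [folklore] **THE TORUS INSERTION (family index on the box, copies summed by `dper`) OF A TORUS PURE GAUGE, at one lattice fluctuation site**: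
`Σ_{u ∈ pbox M} Σ_κ tgrad M (u, inl κ) s · dper M (V κ u) x z a b = (tdelta M (p₁ x) s − tdelta M z s) · q x z a b`. -/
theorem sum_tgrad_mul_dper_of_indexLaw (hM : ∀ i, M i = N * M' i)
    (hVt : ∀ (κ : Fin (d + 1)) (u t : Site (d + 1)), V κ (u + (N : ℤ) • t) = shiftK (-((N : ℤ) • t)) (V κ u))
    (hT : ∀ (κ : Fin (d + 1)) (x z : Site (d + 1)), ∀ u ∉ T x, V κ u x z a b = 0)
    (hlaw : ∀ (w x z : Site (d + 1)), ∑ κ, (V κ (w - unitVec κ) x z a b - V κ w x z a b)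
      = ((if p₁ x = w then (1 : ℝ) else 0) - (if z = w then 1 else 0)) * q x z a b)
    (s : ↥(pbox M)) (x z : Site (d + 1)) :
    ∑ u : ↥(pbox M), ∑ κ : Fin (d + 1), tgrad M (u, Sum.inl κ) s * dper M (V κ (u : Site (d + 1))) x z a b
      = (tdelta M (p₁ x) s - tdelta M z s) * q x z a b := by
  -- the summand as a function of the lattice family index, unfolded along box × period lattice
  set H : Site (d + 1) → ℝ := fun u => ∑ κ, dz (fun w => tdelta M w s) κ u * V κ u x z a b with hH
  have hHs : Summable H :=
    summable_of_ne_finset_zero (s := T x) fun u hu => Finset.sum_eq_zero fun κ _ => by rw [hT κ x z u hu, mul_zero]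
  have hterm : ∀ (u : ↥(pbox M)) (κ : Fin (d + 1)),
      tgrad M (u, Sum.inl κ) s * dper M (V κ (u : Site (d + 1))) x z a b
        = ∑' m : Site (d + 1), dz (fun w => tdelta M w s) κ (translate M (u : Site (d + 1)) m) * V κ (translate M (u : Site (d + 1)) m) x z a b := fun u κ => by
    rw [dper_apply_of_blockCov hM hVt κ (u : Site (d + 1)) x z a b, ← tsum_mul_left]
    refine tsum_congr fun m => ?_
    congr 1
    simp only [tgrad_inl, dz]
    rw [show translate M (u : Site (d + 1)) m + unitVec κ = translate M ((u : Site (d + 1)) + unitVec κ) m by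
        funext i; simp only [B4TorusKernel.MultiPeriod.translate_apply, Pi.add_apply]; ring, tdelta_translate, tdelta_translate]
  have hswap : ∀ u : ↥(pbox M), ∑ κ : Fin (d + 1), tgrad M (u, Sum.inl κ) s * dper M (V κ (u : Site (d + 1))) x z a b
      = ∑' m : Site (d + 1), H (translate M (u : Site (d + 1)) m) := fun u => by
    rw [Finset.sum_congr rfl fun κ _ => hterm u κ, ← Summable.tsum_finsetSum]
    intro κ _
    exact summable_of_ne_finset_zero (s := (T x).preimage _ (translate_injective (M := M) (u : Site (d + 1))).injOn) fun m hm => by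
      rw [hT κ x z _ (fun h => hm (Finset.mem_preimage.2 h)), mul_zero]
  rw [Finset.sum_congr rfl fun u _ => hswap u, ← tsum_sites_eq_sum_tsum M hHs, hH]
  exact tsum_sum_dz_mul_family_of_indexLaw V q p₁ T a b hT hlaw (fun w => tdelta M w s) x z

/-- [folklore] **… AND PERIODISED IN THE FLUCTUATION SLOT** (`hS`: finite fluctuation-slot support, uniform in the family index; `hqS` the same for `q`; `hp₁` the
contact point is a LATTICE function of `x` only — no periodisation there): for every torus gauge parameter `s`,
`Σ_{u ∈ pbox M} Σ_κ tgrad M (u, inl κ) s · perZ M (dper M (V κ u)) x z a b = (tdelta M (p₁ x) s − tdelta M z s) · perZ M q x z a b`. -/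
theorem sum_tgrad_mul_perZ_dper_of_indexLaw (hM : ∀ i, M i = N * M' i)
    (hVt : ∀ (κ : Fin (d + 1)) (u t : Site (d + 1)), V κ (u + (N : ℤ) • t) = shiftK (-((N : ℤ) • t)) (V κ u))
    (hS : ∀ (κ : Fin (d + 1)) (u x : Site (d + 1)), ∀ z ∉ S x, V κ u x z a b = 0)
    (hT : ∀ (κ : Fin (d + 1)) (x z : Site (d + 1)), ∀ u ∉ T x, V κ u x z a b = 0)
    (hqS : ∀ x : Site (d + 1), ∀ z ∉ S x, q x z a b = 0)
    (hlaw : ∀ (w x z : Site (d + 1)), ∑ κ, (V κ (w - unitVec κ) x z a b - V κ w x z a b)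
      = ((if p₁ x = w then (1 : ℝ) else 0) - (if z = w then 1 else 0)) * q x z a b)
    (s : ↥(pbox M)) (x z : Site (d + 1)) :
    ∑ u : ↥(pbox M), ∑ κ : Fin (d + 1), tgrad M (u, Sum.inl κ) s * perZ M (dper M (V κ (u : Site (d + 1)))) x z a b
      = (tdelta M (p₁ x) s - tdelta M z s) * perZ M q x z a b := by
  -- `dper M (V κ u)` keeps the fluctuation-slot support `S x`
  have hdS : ∀ (κ : Fin (d + 1)) (u : Site (d + 1)), ∀ z' ∉ S x, dper M (V κ u) x z' a b = 0 := fun κ u z' hz' => by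
    rw [dper_apply_of_blockCov hM hVt κ u x z' a b]
    exact (tsum_congr fun m => hS κ _ x z' hz').trans tsum_zero
  -- finitely many copies of `z` meet `S x`
  set F : Finset (Site (d + 1)) := (S x).preimage (fun m => translate M z m) (translate_injective (M := M) z).injOn with hF
  have hF' : ∀ m ∉ F, translate M z m ∉ S x := fun m hm hz => hm (Finset.mem_preimage.2 hz)
  have hper : ∀ (u : ↥(pbox M)) (κ : Fin (d + 1)),
      perZ M (dper M (V κ (u : Site (d + 1)))) x z a b = ∑ m ∈ F, dper M (V κ (u : Site (d + 1))) x (translate M z m) a b := fun u κ => by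
    rw [perZ_apply]
    exact tsum_eq_sum fun m hm => hdS κ _ _ (hF' m hm)
  simp only [hper, Finset.mul_sum]
  have h1 : ∀ u : ↥(pbox M), ∑ κ : Fin (d + 1), ∑ m ∈ F, tgrad M (u, Sum.inl κ) s * dper M (V κ (u : Site (d + 1))) x (translate M z m) a b
      = ∑ m ∈ F, ∑ κ : Fin (d + 1), tgrad M (u, Sum.inl κ) s * dper M (V κ (u : Site (d + 1))) x (translate M z m) a b := fun u => Finset.sum_comm
  rw [Finset.sum_congr rfl fun u _ => h1 u, Finset.sum_comm]
  have h2 : ∀ m : Site (d + 1), ∑ u : ↥(pbox M), ∑ κ : Fin (d + 1), tgrad M (u, Sum.inl κ) s * dper M (V κ (u : Site (d + 1))) x (translate M z m) a b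
      = (tdelta M (p₁ x) s - tdelta M z s) * q x (translate M z m) a b := fun m => by
    rw [sum_tgrad_mul_dper_of_indexLaw V q p₁ T a b hM hVt hT hlaw s x (translate M z m), tdelta_translate]
  rw [Finset.sum_congr rfl fun m _ => h2 m, ← Finset.mul_sum, perZ_apply, tsum_eq_sum fun m hm => hqS x _ (hF' m hm)]

end Generic

/-! ## §2 The rooted border table `vhSAt (toSite r) d L`: letters discharged; the contact kernel is `c ×` the torus averaging row -/

section Rooted

variable {M M' : Fin (d + 1) → ℕ} [∀ μ, NeZero (M μ)] {L : ℕ} [NeZero L] {r : Fin (d + 1) → ℕ}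

omit [NeZero L] in
/-- [folklore] **THE INDEX-SLOT LAW OF THE ROOTED TABLE IN `Σ`-FORM** (an1's `divV_vhSAt_inr_inl` with `divV` unfolded):
`Σ_κ (vhSAt ρ κ (w − e_κ) − vhSAt ρ κ w) x z (inr μ) (inl α) = ([x + ρ = w] − [z = w]) · linSymAt ρ L x z (inr μ) (inl α)`. -/
theorem sum_vhSAt_sub_inr_inl (hL : 1 ≤ L) (ρ w x z : Site (d + 1)) (μ α : Fin (d + 1)) :
    ∑ κ : Fin (d + 1), (vhSAt ρ d L rfl κ (w - unitVec κ) x z (Sum.inr μ) (Sum.inl α) - vhSAt ρ d L rfl κ w x z (Sum.inr μ) (Sum.inl α))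
      = ((if x + ρ = w then (1 : ℝ) else 0) - (if z = w then 1 else 0)) * linSymAt ρ L x z (Sum.inr μ) (Sum.inl α) := by
  -- an1's proof, verbatim on the unfolded sum (`divV` is this sum of kernels)
  simp only [vhSAt, AveragingHessianKernels.packVH_inr_inl, AveragingWardRootedStencils.linSymAt_inr_inl]
  by_cases hx : AveragingContours.off L x = 0
  · simp only [hx, if_true]
    rw [AveragingWardRootedStencils.vhKerAt_div_right hL, ← AveragingHessianKernels.eq_smul_blk_of_off_eq_zero hL hx]
  · simp [hx]

/-- [folklore] **`sum_tgrad_mul_perZ_dper_vhSAt` — THE ROOTED BORDER TABLE INSERTED ALONG A TORUS PURE GAUGE** (`M = L·M′`, `r ∈ box`): for the torus gauge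
parameter `s`, the multiplier row `(x, μ)` and the fluctuation leg `(z, α)`,
`Σ_{u ∈ pbox M} Σ_κ tgrad M (u, inl κ) s · perZ M (dper M (vhSAt ρ κ u)) x z (inr μ) (inl α) = (tdelta M (x + ρ) s − tdelta M z s) · perZ M (linSymAt ρ L) x z (inr μ) (inl α)`. -/
theorem sum_tgrad_mul_perZ_dper_vhSAt (hM : ∀ i, M i = L * M' i) (hr : r ∈ box (d + 1) L) (s : ↥(pbox M)) (x z : Site (d + 1)) (μ α : Fin (d + 1)) :
    ∑ u : ↥(pbox M), ∑ κ : Fin (d + 1), tgrad M (u, Sum.inl κ) s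
        * perZ M (dper M (vhSAt (toSite r) d L rfl κ (u : Site (d + 1)))) x z (Sum.inr μ) (Sum.inl α)
      = (tdelta M (x + toSite r) s - tdelta M z s) * perZ M (linSymAt (toSite r) L) x z (Sum.inr μ) (Sum.inl α) := by
  have hL : 1 ≤ L := Nat.one_le_iff_ne_zero.mpr (NeZero.ne L)
  exact sum_tgrad_mul_perZ_dper_of_indexLaw (vhSAt (toSite r) d L rfl) (linSymAt (toSite r) L) (fun x => x + toSite r)
    (fun x => nearBox L (blk L x)) (fun x => nearBox L (blk L x)) (Sum.inr μ) (Sum.inl α) hM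
    (fun κ u t => vhSAt_translate (toSite r) hL κ u t)
    (fun κ u x z hz => vhSAt_inr_inl_eq_zero_of_not_mem hr κ u x μ α hz)
    (fun κ x z u hu => vhSAt_inr_inl_eq_zero_of_not_mem_family hr κ x z μ α hu)
    (fun x z hz => linSymAt_inr_inl_eq_zero_of_not_mem_family hr α x μ hz)
    (fun w x z => sum_vhSAt_sub_inr_inl hL (toSite r) w x z μ α) s x z

omit [∀ μ, NeZero (M μ)] in
/-- [folklore] **THE CONTACT KERNEL IS `c ×` THE TORUS AVERAGING ROW** (g17's `tsum_linSymAt_translate_eq` read in the fluctuation slot):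
`perZ M (linSymAt ρ L) x z (inr μ) (inl α) = (L^{d+1}·stepScale d L j)⁻¹ · perZ M (bhKStepAt d ρ L j) x z (inr μ) (inl α)`. -/
theorem perZ_linSymAt_eq (ρ : Site (d + 1)) (j : ℕ) (x z : Site (d + 1)) (μ α : Fin (d + 1)) :
    perZ M (linSymAt ρ L) x z (Sum.inr μ) (Sum.inl α) = (((L : ℝ) ^ (d + 1) * stepScale d L j)⁻¹) * perZ M (bhKStepAt d ρ L j) x z (Sum.inr μ) (Sum.inl α) := by
  rw [perZ_apply]
  exact tsum_linSymAt_translate_eq (M := M) ρ j x z μ α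

/-- [folklore] **IN THE TORUS CALL's LETTERS**: `Σ_u Σ_κ tgrad M (u, inl κ) s · perZ M (dper M (vhSAt ρ κ u)) x z (inr μ) (inl α)
= c · (tdelta M (x + ρ) s · perZ M (bhKStepAt d ρ L j) x z (inr μ) (inl α) − perZ M (bhKStepAt d ρ L j) x z (inr μ) (inl α) · tdelta M z s)`, `c = (L^{d+1}·stepScale d L j)⁻¹`
— the multiplier rotates at the ROOT `x + ρ` of its block, the fluctuation leg at its BASE `z`. -/
theorem sum_tgrad_mul_perZ_dper_vhSAt_bhKStepAt (hM : ∀ i, M i = L * M' i) (hr : r ∈ box (d + 1) L) (j : ℕ) (s : ↥(pbox M)) (x z : Site (d + 1))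
    (μ α : Fin (d + 1)) :
    ∑ u : ↥(pbox M), ∑ κ : Fin (d + 1), tgrad M (u, Sum.inl κ) s
        * perZ M (dper M (vhSAt (toSite r) d L rfl κ (u : Site (d + 1)))) x z (Sum.inr μ) (Sum.inl α)
      = (((L : ℝ) ^ (d + 1) * stepScale d L j)⁻¹)
        * (tdelta M (x + toSite r) s * perZ M (bhKStepAt d (toSite r) L j) x z (Sum.inr μ) (Sum.inl α)
            - perZ M (bhKStepAt d (toSite r) L j) x z (Sum.inr μ) (Sum.inl α) * tdelta M z s) := by
  rw [sum_tgrad_mul_perZ_dper_vhSAt hM hr s x z μ α, perZ_linSymAt_eq (M := M) (toSite r) j x z μ α]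
  ring

end Rooted

/-! ## §3 Matrix form at the torus call's types: `Σ_b tgrad_{b s} • Q₁₁^{b} = c • (R_s·Q₁₀ − Q₁₀·E_s)`; any torus gauge function `λ` -/

section TorusCall

variable (M' : Fin (d + 1) → ℕ) [∀ μ, NeZero (M' μ)] {Lc : ℕ} [NeZero Lc] {r : Fin (d + 1) → ℕ}

/-- [folklore] **ANY BOX, ANY MULTIPLIER PRESENTATION** (`M = L·M″`, root `toSite r`, `r ∈ box`; multiplier rows `a ↦ (pμ a, inr (mμ a))` with `pμ a ∈ pbox M` —
e.g. the Delta's coarse-coarse presentation `(pμ′, inr mμ′)` on the coarse box ONE LEVEL UP): for every torus gauge parameter `s`,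
`Σ_b tgrad M (b.1, inl b.2) s • Q₁^{b} = c • (R_s * Q₀ − Q₀ * E_s)` with `Q₀ := perF M (bhKStepAt d (toSite r) L j)∘((pμ, inr mμ), fields)`,
`Q₁^{b} := perF M (dper M (vhSAt (toSite r) d L rfl b.2 b.1))∘((pμ, inr mμ), fields)`, `E_s = diagonal (tdelta M b.1 s)`, `R_s = diagonal (tdelta M (pμ a + toSite r) s)`. -/
theorem torus_pureGauge_of_presentation {M M'' : Fin (d + 1) → ℕ} [∀ μ, NeZero (M μ)] {L : ℕ} [NeZero L] {r : Fin (d + 1) → ℕ}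
    (hM : ∀ i, M i = L * M'' i) (hr : r ∈ box (d + 1) L) (j : ℕ) (s : ↥(pbox M))
    {κI : Type*} [Fintype κI] [DecidableEq κI] (pμ : κI → Site (d + 1)) (hpμ : ∀ a, pμ a ∈ pbox M) (mμ : κI → Fin (d + 1))
    {Q₀ : Matrix κI (↥(pbox M) × Fin (d + 1)) ℝ}
    (hQ₀ : Q₀ = (perF M (bhKStepAt d (toSite r) L j)).submatrix (fun a : κI => ((⟨pμ a, hpμ a⟩, Sum.inr (mμ a)) : Idx M (Fib d)))
        (fun b : ↥(pbox M) × Fin (d + 1) => ((b.1, Sum.inl b.2) : Idx M (Fib d)))) :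
    (∑ b : ↥(pbox M) × Fin (d + 1), tgrad M (b.1, Sum.inl b.2) s •
        (perF M (dper M (vhSAt (toSite r) d L rfl b.2 (b.1 : Site (d + 1))))).submatrix
          (fun a : κI => ((⟨pμ a, hpμ a⟩, Sum.inr (mμ a)) : Idx M (Fib d)))
          (fun b : ↥(pbox M) × Fin (d + 1) => ((b.1, Sum.inl b.2) : Idx M (Fib d))))
      = (((L : ℝ) ^ (d + 1) * stepScale d L j)⁻¹) •
          (Matrix.diagonal (fun a : κI => tdelta M (pμ a + toSite r) s) * Q₀
            - Q₀ * Matrix.diagonal (fun b : ↥(pbox M) × Fin (d + 1) => tdelta M (b.1 : Site (d + 1)) s)) := by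
  subst hQ₀
  ext a b'
  rw [Matrix.sum_apply, Matrix.smul_apply, Matrix.sub_apply, Matrix.diagonal_mul, Matrix.mul_diagonal, smul_eq_mul]
  simp only [Matrix.smul_apply, Matrix.submatrix_apply, perF_apply, smul_eq_mul]
  rw [Fintype.sum_prod_type]
  exact sum_tgrad_mul_perZ_dper_vhSAt_bhKStepAt (M := M) (M' := M'') hM hr j s _ _ (mμ a) b'.2

/-- [folklore] **ANY BOX, ANY MULTIPLIER PRESENTATION, ANY TORUS GAUGE FUNCTION** `λ : ↥(pbox M) → ℝ`:
`Σ_b (Dλ)_b • Q₁^{b} = c • (R_λ * Q₀ − Q₀ * E_λ)`, `E_λ = diagonal (λ b.1)`, `R_λ = diagonal (Σ_s tdelta M (pμ a + toSite r) s · λ s)`. -/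
theorem torus_pureGauge_fun_of_presentation {M M'' : Fin (d + 1) → ℕ} [∀ μ, NeZero (M μ)] {L : ℕ} [NeZero L] {r : Fin (d + 1) → ℕ}
    (hM : ∀ i, M i = L * M'' i) (hr : r ∈ box (d + 1) L) (j : ℕ) (lam : ↥(pbox M) → ℝ)
    {κI : Type*} [Fintype κI] [DecidableEq κI] (pμ : κI → Site (d + 1)) (hpμ : ∀ a, pμ a ∈ pbox M) (mμ : κI → Fin (d + 1))
    {Q₀ : Matrix κI (↥(pbox M) × Fin (d + 1)) ℝ}
    (hQ₀ : Q₀ = (perF M (bhKStepAt d (toSite r) L j)).submatrix (fun a : κI => ((⟨pμ a, hpμ a⟩, Sum.inr (mμ a)) : Idx M (Fib d)))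
        (fun b : ↥(pbox M) × Fin (d + 1) => ((b.1, Sum.inl b.2) : Idx M (Fib d)))) :
    (∑ b : ↥(pbox M) × Fin (d + 1), (∑ s : ↥(pbox M), tgrad M (b.1, Sum.inl b.2) s * lam s) •
        (perF M (dper M (vhSAt (toSite r) d L rfl b.2 (b.1 : Site (d + 1))))).submatrix
          (fun a : κI => ((⟨pμ a, hpμ a⟩, Sum.inr (mμ a)) : Idx M (Fib d)))
          (fun b : ↥(pbox M) × Fin (d + 1) => ((b.1, Sum.inl b.2) : Idx M (Fib d))))
      = (((L : ℝ) ^ (d + 1) * stepScale d L j)⁻¹) •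
          (Matrix.diagonal (fun a : κI => ∑ s : ↥(pbox M), tdelta M (pμ a + toSite r) s * lam s) * Q₀
            - Q₀ * Matrix.diagonal (fun b : ↥(pbox M) × Fin (d + 1) => lam b.1)) := by
  have hswap : (∑ b : ↥(pbox M) × Fin (d + 1), (∑ s : ↥(pbox M), tgrad M (b.1, Sum.inl b.2) s * lam s) •
        (perF M (dper M (vhSAt (toSite r) d L rfl b.2 (b.1 : Site (d + 1))))).submatrix
          (fun a : κI => ((⟨pμ a, hpμ a⟩, Sum.inr (mμ a)) : Idx M (Fib d)))
          (fun b : ↥(pbox M) × Fin (d + 1) => ((b.1, Sum.inl b.2) : Idx M (Fib d))))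
      = ∑ s : ↥(pbox M), lam s • ∑ b : ↥(pbox M) × Fin (d + 1), tgrad M (b.1, Sum.inl b.2) s •
        (perF M (dper M (vhSAt (toSite r) d L rfl b.2 (b.1 : Site (d + 1))))).submatrix
          (fun a : κI => ((⟨pμ a, hpμ a⟩, Sum.inr (mμ a)) : Idx M (Fib d)))
          (fun b : ↥(pbox M) × Fin (d + 1) => ((b.1, Sum.inl b.2) : Idx M (Fib d))) := by
    simp only [Finset.sum_smul, Finset.smul_sum, smul_smul, mul_comm (lam _)]
    exact Finset.sum_comm
  rw [hswap, Finset.sum_congr rfl fun s _ => by rw [torus_pureGauge_of_presentation hM hr j s pμ hpμ mμ hQ₀]]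
  ext a b'
  simp only [Matrix.sum_apply, Matrix.smul_apply, Matrix.sub_apply, Matrix.diagonal_mul, Matrix.mul_diagonal, smul_eq_mul]
  rw [show lam b'.1 = ∑ s : ↥(pbox M), tdelta M ((b'.1 : ↥(pbox M)) : Site (d + 1)) s * lam s by rw [sum_tdelta_mul, wrapPt_of_mem]]
  simp only [Finset.mul_sum, Finset.sum_mul, mul_sub, Finset.sum_sub_distrib]
  congr 1 <;> exact Finset.sum_congr rfl fun s _ => by ring

/-- [folklore] **`Q₁^{(D e_s)} = c·(R_s·Q₁₀ − Q₁₀·E_s)` AT THE TORUS CALL's TYPES** (fine box `fine Lc M′`, root `r ∈ box`; `hQ₁₀` VERBATIM from p313662 ∕ the Delta;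
`Q₁₁^{b} := perF(dper(vhSAt (toSite r) d Lc rfl b.2 b.1))∘((coarsePt, inr), fields)` as in p314580): for every torus gauge parameter `s`,
`Σ_b tgrad F (b.1, inl b.2) s • Q₁₁^{b} = c • (R_s * Q₁₀ − Q₁₀ * E_s)` with the DIAGONAL generators `E_s := diagonal (fun b => tdelta F b.1 s)` (fields, at the base of
their bond) and `R_s := diagonal (fun a => tdelta F (Lc•a.1 + toSite r) s)` (multipliers, at the root of their block), `c = (Lc^{d+1}·stepScale d Lc j)⁻¹`. -/
theorem torus_Q11_pureGauge (hr : r ∈ box (d + 1) Lc) (j : ℕ) (s : ↥(pbox (fine Lc M')))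
    {Q₁₀ : Matrix (↥(pbox M') × Fin (d + 1)) (↥(pbox (fine Lc M')) × Fin (d + 1)) ℝ}
    (hQ₁₀ : Q₁₀ = (perF (fine Lc M') (bhKStepAt d (toSite r) Lc j)).submatrix
        (fun a : ↥(pbox M') × Fin (d + 1) => ((coarsePt M' Lc a.1, Sum.inr a.2) : Idx (fine Lc M') (Fib d)))
        (fun b : ↥(pbox (fine Lc M')) × Fin (d + 1) => ((b.1, Sum.inl b.2) : Idx (fine Lc M') (Fib d)))) :
    (∑ b : ↥(pbox (fine Lc M')) × Fin (d + 1), tgrad (fine Lc M') (b.1, Sum.inl b.2) s •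
        (perF (fine Lc M') (dper (fine Lc M') (vhSAt (toSite r) d Lc rfl b.2 (b.1 : Site (d + 1))))).submatrix
          (fun a : ↥(pbox M') × Fin (d + 1) => ((coarsePt M' Lc a.1, Sum.inr a.2) : Idx (fine Lc M') (Fib d)))
          (fun b : ↥(pbox (fine Lc M')) × Fin (d + 1) => ((b.1, Sum.inl b.2) : Idx (fine Lc M') (Fib d))))
      = (((Lc : ℝ) ^ (d + 1) * stepScale d Lc j)⁻¹) •
          (Matrix.diagonal (fun a : ↥(pbox M') × Fin (d + 1) => tdelta (fine Lc M') ((Lc : ℤ) • (a.1 : Site (d + 1)) + toSite r) s) * Q₁₀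
            - Q₁₀ * Matrix.diagonal (fun b : ↥(pbox (fine Lc M')) × Fin (d + 1) => tdelta (fine Lc M') (b.1 : Site (d + 1)) s)) := by
  subst hQ₁₀
  ext a b'
  rw [Matrix.sum_apply, Matrix.smul_apply, Matrix.sub_apply, Matrix.diagonal_mul, Matrix.mul_diagonal, smul_eq_mul]
  simp only [Matrix.smul_apply, Matrix.submatrix_apply, perF_apply, smul_eq_mul, coarsePt_coe]
  rw [Fintype.sum_prod_type]
  exact sum_tgrad_mul_perZ_dper_vhSAt_bhKStepAt (M := fine Lc M') (M' := M') (fun i => rfl) hr j s _ _ a.2 b'.2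

/-- [folklore] **ALONG ANY TORUS GAUGE FUNCTION** `λ : ↥(pbox F) → ℝ` (`h_b := Σ_s tgrad F b s · λ s = (Dλ)_b`):
`Σ_b (Dλ)_b • Q₁₁^{b} = c • (R_λ * Q₁₀ − Q₁₀ * E_λ)`, `E_λ := diagonal (fun b => λ b.1)` (the field leg's base is a box point), `R_λ := diagonal (fun a => Σ_s tdelta F (Lc•a.1 + ρ) s · λ s)`
(= `λ` at the box representative of the multiplier's block root). -/
theorem torus_Q11_pureGauge_fun (hr : r ∈ box (d + 1) Lc) (j : ℕ) (lam : ↥(pbox (fine Lc M')) → ℝ)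
    {Q₁₀ : Matrix (↥(pbox M') × Fin (d + 1)) (↥(pbox (fine Lc M')) × Fin (d + 1)) ℝ}
    (hQ₁₀ : Q₁₀ = (perF (fine Lc M') (bhKStepAt d (toSite r) Lc j)).submatrix
        (fun a : ↥(pbox M') × Fin (d + 1) => ((coarsePt M' Lc a.1, Sum.inr a.2) : Idx (fine Lc M') (Fib d)))
        (fun b : ↥(pbox (fine Lc M')) × Fin (d + 1) => ((b.1, Sum.inl b.2) : Idx (fine Lc M') (Fib d)))) :
    (∑ b : ↥(pbox (fine Lc M')) × Fin (d + 1), (∑ s : ↥(pbox (fine Lc M')), tgrad (fine Lc M') (b.1, Sum.inl b.2) s * lam s) •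
        (perF (fine Lc M') (dper (fine Lc M') (vhSAt (toSite r) d Lc rfl b.2 (b.1 : Site (d + 1))))).submatrix
          (fun a : ↥(pbox M') × Fin (d + 1) => ((coarsePt M' Lc a.1, Sum.inr a.2) : Idx (fine Lc M') (Fib d)))
          (fun b : ↥(pbox (fine Lc M')) × Fin (d + 1) => ((b.1, Sum.inl b.2) : Idx (fine Lc M') (Fib d))))
      = (((Lc : ℝ) ^ (d + 1) * stepScale d Lc j)⁻¹) •
          (Matrix.diagonal (fun a : ↥(pbox M') × Fin (d + 1) =>
              ∑ s : ↥(pbox (fine Lc M')), tdelta (fine Lc M') ((Lc : ℤ) • (a.1 : Site (d + 1)) + toSite r) s * lam s) * Q₁₀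
            - Q₁₀ * Matrix.diagonal (fun b : ↥(pbox (fine Lc M')) × Fin (d + 1) => lam b.1)) := by
  -- linearity in `s`: swap the two finite sums and use `torus_Q11_pureGauge` for each `s`
  have hswap : (∑ b : ↥(pbox (fine Lc M')) × Fin (d + 1), (∑ s : ↥(pbox (fine Lc M')), tgrad (fine Lc M') (b.1, Sum.inl b.2) s * lam s) •
        (perF (fine Lc M') (dper (fine Lc M') (vhSAt (toSite r) d Lc rfl b.2 (b.1 : Site (d + 1))))).submatrix
          (fun a : ↥(pbox M') × Fin (d + 1) => ((coarsePt M' Lc a.1, Sum.inr a.2) : Idx (fine Lc M') (Fib d)))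
          (fun b : ↥(pbox (fine Lc M')) × Fin (d + 1) => ((b.1, Sum.inl b.2) : Idx (fine Lc M') (Fib d))))
      = ∑ s : ↥(pbox (fine Lc M')), lam s • ∑ b : ↥(pbox (fine Lc M')) × Fin (d + 1), tgrad (fine Lc M') (b.1, Sum.inl b.2) s •
        (perF (fine Lc M') (dper (fine Lc M') (vhSAt (toSite r) d Lc rfl b.2 (b.1 : Site (d + 1))))).submatrix
          (fun a : ↥(pbox M') × Fin (d + 1) => ((coarsePt M' Lc a.1, Sum.inr a.2) : Idx (fine Lc M') (Fib d)))
          (fun b : ↥(pbox (fine Lc M')) × Fin (d + 1) => ((b.1, Sum.inl b.2) : Idx (fine Lc M') (Fib d))) := by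
    simp only [Finset.sum_smul, Finset.smul_sum, smul_smul, mul_comm (lam _)]
    exact Finset.sum_comm
  rw [hswap, Finset.sum_congr rfl fun s _ => by rw [torus_Q11_pureGauge M' hr j s hQ₁₀]]
  -- collect entrywise: `Σ_s λ s · c · (t_R(a,s)·Q a b' − Q a b'·t_E(b',s)) = c · ((Σ_s t_R(a,s) λ s)·Q a b' − Q a b'·λ b'.1)`
  ext a b'
  simp only [Matrix.sum_apply, Matrix.smul_apply, Matrix.sub_apply, Matrix.diagonal_mul, Matrix.mul_diagonal, smul_eq_mul]
  rw [show lam b'.1 = ∑ s : ↥(pbox (fine Lc M')), tdelta (fine Lc M') ((b'.1 : ↥(pbox (fine Lc M'))) : Site (d + 1)) s * lam s by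
    rw [sum_tdelta_mul, wrapPt_of_mem]]
  simp only [Finset.mul_sum, Finset.sum_mul, mul_sub, Finset.sum_sub_distrib]
  congr 1 <;> exact Finset.sum_congr rfl fun s _ => by ring

/-! ## §4 The first-order CONJUGATED AVERAGING WORD of the OWNER's `SliceTransportConjugationEnd.secondVar_kkt_conj_transport` at diagonal torus-gauge transports -/

/-- [folklore] **(T-β-1) AT ORDER 1 FOR THE AVERAGING BLOCK, IN THE OWNER's WORD SHAPE**: with the base transports `A₀ = Ā₀ = 1` and the first transport jets DIAGONAL,
`A₁ := −c • E_λ` (fields), `Ā₁ := c • R_λ` (multipliers), for ANY direction `h` on the fine torus bonds the conjugated first-order averaging word of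
`secondVar_kkt_conj_transport` is the insertion table along the SHIFTED direction `h + Dλ`:
`Ā₁ * Q₁₀ * A₀ + Ā₀ * Q₁^{(h)} * A₀ + Ā₀ * Q₁₀ * A₁ = Q₁^{(h + Dλ)}`, `Q₁^{(h)} := Σ_b h b • Q₁₁^{b}`, `(Dλ)_b := Σ_s tgrad F b s · λ s`. -/
theorem torus_conj_first_averaging_word (hr : r ∈ box (d + 1) Lc) (j : ℕ) (h : ↥(pbox (fine Lc M')) × Fin (d + 1) → ℝ) (lam : ↥(pbox (fine Lc M')) → ℝ)
    {Q₁₀ : Matrix (↥(pbox M') × Fin (d + 1)) (↥(pbox (fine Lc M')) × Fin (d + 1)) ℝ}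
    (hQ₁₀ : Q₁₀ = (perF (fine Lc M') (bhKStepAt d (toSite r) Lc j)).submatrix
        (fun a : ↥(pbox M') × Fin (d + 1) => ((coarsePt M' Lc a.1, Sum.inr a.2) : Idx (fine Lc M') (Fib d)))
        (fun b : ↥(pbox (fine Lc M')) × Fin (d + 1) => ((b.1, Sum.inl b.2) : Idx (fine Lc M') (Fib d)))) :
    ((((Lc : ℝ) ^ (d + 1) * stepScale d Lc j)⁻¹) •
          Matrix.diagonal (fun a : ↥(pbox M') × Fin (d + 1) =>
            ∑ s : ↥(pbox (fine Lc M')), tdelta (fine Lc M') ((Lc : ℤ) • (a.1 : Site (d + 1)) + toSite r) s * lam s)) * Q₁₀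
          * (1 : Matrix (↥(pbox (fine Lc M')) × Fin (d + 1)) (↥(pbox (fine Lc M')) × Fin (d + 1)) ℝ)
        + (1 : Matrix (↥(pbox M') × Fin (d + 1)) (↥(pbox M') × Fin (d + 1)) ℝ) * (∑ b : ↥(pbox (fine Lc M')) × Fin (d + 1), h b •
            (perF (fine Lc M') (dper (fine Lc M') (vhSAt (toSite r) d Lc rfl b.2 (b.1 : Site (d + 1))))).submatrix
              (fun a : ↥(pbox M') × Fin (d + 1) => ((coarsePt M' Lc a.1, Sum.inr a.2) : Idx (fine Lc M') (Fib d)))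
              (fun b : ↥(pbox (fine Lc M')) × Fin (d + 1) => ((b.1, Sum.inl b.2) : Idx (fine Lc M') (Fib d))))
          * (1 : Matrix (↥(pbox (fine Lc M')) × Fin (d + 1)) (↥(pbox (fine Lc M')) × Fin (d + 1)) ℝ)
        + (1 : Matrix (↥(pbox M') × Fin (d + 1)) (↥(pbox M') × Fin (d + 1)) ℝ) * Q₁₀ * (-((((Lc : ℝ) ^ (d + 1) * stepScale d Lc j)⁻¹) •
            Matrix.diagonal (fun b : ↥(pbox (fine Lc M')) × Fin (d + 1) => lam b.1)))
      = ∑ b : ↥(pbox (fine Lc M')) × Fin (d + 1), (h b + ∑ s : ↥(pbox (fine Lc M')), tgrad (fine Lc M') (b.1, Sum.inl b.2) s * lam s) •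
          (perF (fine Lc M') (dper (fine Lc M') (vhSAt (toSite r) d Lc rfl b.2 (b.1 : Site (d + 1))))).submatrix
            (fun a : ↥(pbox M') × Fin (d + 1) => ((coarsePt M' Lc a.1, Sum.inr a.2) : Idx (fine Lc M') (Fib d)))
            (fun b : ↥(pbox (fine Lc M')) × Fin (d + 1) => ((b.1, Sum.inl b.2) : Idx (fine Lc M') (Fib d))) := by
  rw [Matrix.mul_one, Matrix.mul_one, Matrix.one_mul, Matrix.one_mul, Matrix.mul_neg, Matrix.mul_smul, Matrix.smul_mul]
  simp only [add_smul, Finset.sum_add_distrib]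
  rw [torus_Q11_pureGauge_fun M' hr j lam hQ₁₀, smul_sub]
  abel

end TorusCall

end Summit.QuantumFields.BalabanUV.Beta.FP.PeriodisedBorderIndexWard

end
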